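import Mathlib
import Summits.ValiantsHypothesis.ValiantsHypothesis.Theorems.DivisionGapPerCofactorDegreeReductionStubDominantHoleIsolation
import Summits.ValiantsHypothesis.ValiantsHypothesis.Theorems.DivisionGapPerCofactorDegreeReductionStubMemberDescent
import Summits.ValiantsHypothesis.ValiantsHypothesis.Theorems.DivisionGapPerCofactorDegreeReductionStubIsolatedStrip
import Summits.ValiantsHypothesis.ValiantsHypothesis.Theorems.DivisionGapPerCofactorDegreeReductionStubBlockProjection
import Summits.ValiantsHypothesis.ValiantsHypothesis.Theorems.DivisionGapPerDivisionHardStubJssContraction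
import Summits.ValiantsHypothesis.ValiantsHypothesis.Theorems.DivisionGapPerDivisionHardStubSparseRigidCount
import Literature.Computability.AlgebraicComplexity.ValiantClassesProofs
import Literature.Computability.AlgebraicComplexity.PermanentIrreducible

/-!
# `DivisionGap.PerCofactorDegreeReduction` (stmt-ValiantsHypothesis-15046), line `Sketch_ideator4`:
the block fibre rung (stub `stub_blockFibreRung`, W)

The recursion step of the dominant-monomial isolation: the multiplier `h` (over `ℝ≥0`) is
TORUS-HOMOGENEOUS (all monomials share their row-sum and column-sum vectors) and its monomial `u`
is DOMINANT (`v ≤ u` on `supp u` for every monomial `v` of `h`); the BLOCK is `er(Fin m) × ec(Fin m)`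
(`er`, `ec` injective) and every column `j` off the range of `ec` carries a cell `(M₀ j, j)` of
`supp u` in a row off the range of `er`, injectively in `j`.  No emptiness of `u` on the block is
assumed (compare `DominantHoleIsolation.stub_dominantHoleIsolation`).  Then, with
`s = L(per_n · h)`:

* the host `G = supp u ∪ Vr ×ˢ Vc` (`Vr = image er`, `Vc = image ec`) carries exactly the BLOCK
  FIBRE `Fib` of `u` — the monomials `v` of `h` with `v = u` OFF the block (`eq_off_block`, the
  margin double count of the dominant hole isolation without the empty-block hypothesis, and its
  converse; `filter_host_eq_fibre`);
* member descent (`MemberDescent.stub_memberDescent`): `L(per_G · Σ_{v ∈ Fib} h_v x^v) ≤ s`, and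
  `Σ_{v ∈ Fib} h_v x^v = x^{u_off} · hV` with `u_off` the off-block part of `u` and
  `hV = Σ_{v ∈ Fib} h_v x^{v - u_off}` (`monomial_fibre_eq_mul`);
* the Jukna–Seiwert–Sergeev contraction (`stub_jssContraction`) strips `x^{u_off}`:
  `L(per_G · hV) ≤ ((n+2)(s+2))^κ`;
* the block projection (`BlockProjection.exists_subst`, `BlockProjection.aeval_facePer_eq_perPoly`)
  sends `per_G` to `per_m` and `hV` to the fibre polynomial `h'` transported to the block
  (`aeval_monomial_fibre`: `x^{v - u_off} ↦ x^{v|block}`), at no cost.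

Hence `L(per_m · h') ≤ ((n+2)(s+3))^κ`, and the monomials of `h'` are exactly the block
restrictions of the fibre (`mem_support_sum_monomial_iff`, no cancellation over `ℝ≥0`).
No definitions in this file. [folklore]
-/

noncomputable section

-- `Summit.ValiantsHypothesis.ValiantsHypothesis.…` is the tree's mandated single-conjunct layout
-- (Sub = Summit), so the duplicated namespace component is intended.
set_option linter.dupNamespace false

open MvPolynomial Literature.Computability.AlgebraicComplexity
open Summit.ValiantsHypothesis.ValiantsHypothesis.Theorems.DivisionGapPerDivisionHard
  (facePer rowDegrees_apply colDegrees_apply)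
open scoped NNReal

namespace Summit.ValiantsHypothesis.ValiantsHypothesis.Theorems.DivisionGap.PerCofactorDegreeReduction.BlockFibre

variable {n m : ℕ}

/-! ### The host carries the block fibre -/

/-- **Off-block agreement** (the margin double count of the dominant hole isolation, without the
empty-block hypothesis).  If `h` is torus-homogeneous, `u ∈ supp h` dominates every monomial of
`h` on `supp u`, and the monomial `v` of `h` is supported inside `supp u ∪ Vr ×ˢ Vc`, then
`v = u` OFF the block `Vr × Vc`: off the block `v ≤ u` pointwise; a row off `Vr` (a column off
`Vc`) is entirely off-block with the same sum for `v` and `u`, hence agrees termwise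
(`DominantHoleIsolation.eq_of_le_of_sum_eq`); every off-block cell lies in such a row or column.
[folklore] -/
theorem eq_off_block (h : MvPolynomial (Fin n × Fin n) ℝ≥0) (u : (Fin n × Fin n) →₀ ℕ)
    (Vr Vc : Finset (Fin n)) (hu : u ∈ h.support)
    (hτ : ∃ τ : (Fin n →₀ ℕ) × (Fin n →₀ ℕ),
      ∀ v ∈ h.support, (Finsupp.mapDomain Prod.fst v, Finsupp.mapDomain Prod.snd v) = τ)
    (hdom : ∀ v ∈ h.support, ∀ e ∈ u.support, v e ≤ u e)
    {v : (Fin n × Fin n) →₀ ℕ} (hv : v ∈ h.support) (hsub : v.support ⊆ u.support ∪ Vr ×ˢ Vc)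
    (e : Fin n × Fin n) (he : ¬(e.1 ∈ Vr ∧ e.2 ∈ Vc)) : v e = u e := by
  obtain ⟨τ, hτ⟩ := hτ
  obtain ⟨hrow, hcol⟩ := Prod.mk.inj ((hτ v hv).trans (hτ u hu).symm)
  have hrowSum : ∀ i, ∑ j, v (i, j) = ∑ j, u (i, j) := fun i => by
    rw [← rowDegrees_apply, ← rowDegrees_apply]
    exact DFunLike.congr_fun hrow i
  have hcolSum : ∀ j, ∑ i, v (i, j) = ∑ i, u (i, j) := fun j => by
    rw [← colDegrees_apply, ← colDegrees_apply, hcol]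
  -- off the block, `v ≤ u` pointwise
  have hle : ∀ e : Fin n × Fin n, ¬(e.1 ∈ Vr ∧ e.2 ∈ Vc) → v e ≤ u e := by
    intro e he
    by_cases hev : e ∈ v.support
    · rcases Finset.mem_union.1 (hsub hev) with heu | heb
      · exact hdom v hv e heu
      · exact absurd (Finset.mem_product.1 heb) he
    · rw [Finsupp.notMem_support_iff.1 hev]
      exact Nat.zero_le _
  obtain ⟨i, j⟩ := e
  by_cases hi : i ∈ Vr
  · -- the column `j` lies off `Vc` and agrees termwise
    have hj : j ∉ Vc := fun hj => he ⟨hi, hj⟩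
    exact DominantHoleIsolation.eq_of_le_of_sum_eq (f := fun i => v (i, j)) (g := fun i => u (i, j))
      (fun i => hle (i, j) fun hb => hj hb.2) (hcolSum j) i
  · -- the row `i` lies off `Vr` and agrees termwise
    exact DominantHoleIsolation.eq_of_le_of_sum_eq (f := fun j => v (i, j)) (g := fun j => u (i, j))
      (fun j => hle (i, j) fun hb => hi hb.1) (hrowSum i) j

/-- A cell is a block cell `(er a, ec b)` iff its row is a block row and its column is a block
column. [folklore] -/
theorem exists_eq_block_iff (er ec : Fin m → Fin n) (e : Fin n × Fin n) :
    (∃ a b, e = (er a, ec b)) ↔ e.1 ∈ Finset.univ.image er ∧ e.2 ∈ Finset.univ.image ec := by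
  simp only [Finset.mem_image, Finset.mem_univ, true_and]
  constructor
  · rintro ⟨a, b, rfl⟩
    exact ⟨⟨a, rfl⟩, ⟨b, rfl⟩⟩
  · rintro ⟨⟨a, ha⟩, ⟨b, hb⟩⟩
    exact ⟨a, b, Prod.ext ha.symm hb.symm⟩

/-- A cell is off the block iff it is not the case that its row is a block row and its column a
block column. [folklore] -/
theorem off_iff (er ec : Fin m → Fin n) (e : Fin n × Fin n) :
    (∀ a b, e ≠ (er a, ec b)) ↔ ¬(e.1 ∈ Finset.univ.image er ∧ e.2 ∈ Finset.univ.image ec) := by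
  rw [← exists_eq_block_iff]
  simp only [not_exists, ne_eq]

/-- **The host carries exactly the block fibre.**  For the host `G = supp u ∪ Vr ×ˢ Vc` (`Vr`, `Vc`
the block rows and columns) the monomials of `h` supported inside `G` are exactly the monomials of
`h` that agree with `u` off the block (`eq_off_block`; conversely an off-block cell `e` of such a
`v` with `v e ≠ 0` has `u e ≠ 0`, and the other cells are block cells). [folklore] -/
theorem filter_host_eq_fibre (h : MvPolynomial (Fin n × Fin n) ℝ≥0) (u : (Fin n × Fin n) →₀ ℕ)
    (er ec : Fin m → Fin n) (hu : u ∈ h.support)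
    (hτ : ∃ τ : (Fin n →₀ ℕ) × (Fin n →₀ ℕ),
      ∀ v ∈ h.support, (Finsupp.mapDomain Prod.fst v, Finsupp.mapDomain Prod.snd v) = τ)
    (hdom : ∀ v ∈ h.support, ∀ e ∈ u.support, v e ≤ u e) :
    h.support.filter (fun v => v.support ⊆
        u.support ∪ (Finset.univ.image er) ×ˢ (Finset.univ.image ec)) =
      h.support.filter
        (fun v => ∀ e : Fin n × Fin n, (∀ a b, e ≠ (er a, ec b)) → v e = u e) := by
  refine Finset.filter_congr fun v hv => ⟨fun hsub e he => ?_, fun hoff e hev => ?_⟩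
  · exact eq_off_block h u _ _ hu hτ hdom hv hsub e ((off_iff er ec e).1 he)
  · rw [Finset.mem_union, Finset.mem_product, ← exists_eq_block_iff]
    by_cases he : ∀ a b, e ≠ (er a, ec b)
    · left
      rw [Finsupp.mem_support_iff, ← hoff e he]
      exact Finsupp.mem_support_iff.1 hev
    · right
      simpa only [not_forall, ne_eq, not_not] using he

/-! ### The common off-block factor and the block restriction -/

/-- Off the block a fibre monomial `v` equals `u`, so `x^v = x^{u_off} · x^{v - u_off}` with
`u_off` the off-block part of `u` (`monomial_mul`, `add_tsub_cancel_of_le`). [folklore] -/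
theorem monomial_fibre_eq_mul (u : (Fin n × Fin n) →₀ ℕ) (er ec : Fin m → Fin n)
    {v : (Fin n × Fin n) →₀ ℕ}
    (hoff : ∀ e : Fin n × Fin n, (∀ a b, e ≠ (er a, ec b)) → v e = u e) (c : ℝ≥0) :
    monomial v c = monomial (u.filter fun e => ∀ a b, e ≠ (er a, ec b)) (1 : ℝ≥0) *
      monomial (v - u.filter fun e => ∀ a b, e ≠ (er a, ec b)) c := by
  rw [monomial_mul, one_mul, add_tsub_cancel_of_le]
  refine Finsupp.le_def.2 fun e => ?_
  rw [Finsupp.filter_apply]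
  split_ifs with he
  · exact (hoff e he).ge
  · exact Nat.zero_le _

/-- The block substitution (`x_{(er a, ec b)} ↦ X_{(a, b)}`) sends the shifted fibre monomial
`x^{v - u_off}` — supported inside the block, where `u_off` vanishes — to the monomial of the
block restriction `(a, b) ↦ v (er a, ec b)` of `v`. [folklore] -/
theorem aeval_monomial_fibre {er ec : Fin m → Fin n} (her : Function.Injective er)
    (hec : Function.Injective ec) {φ : Fin n × Fin n → MvPolynomial (Fin m × Fin m) ℝ≥0}
    (hφX : ∀ a b, φ (er a, ec b) = X (a, b)) (u : (Fin n × Fin n) →₀ ℕ)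
    {v : (Fin n × Fin n) →₀ ℕ}
    (hoff : ∀ e : Fin n × Fin n, (∀ a b, e ≠ (er a, ec b)) → v e = u e) (c : ℝ≥0) :
    aeval φ (monomial (v - u.filter fun e => ∀ a b, e ≠ (er a, ec b)) c) =
      monomial (Finsupp.equivFunOnFinite.symm fun p : Fin m × Fin m => v (er p.1, ec p.2)) c := by
  -- the shifted monomial vanishes off the block and equals `v` on it
  have hblk : ∀ a b, (v - u.filter fun e => ∀ a b, e ≠ (er a, ec b)) (er a, ec b) =
      v (er a, ec b) := fun a b => by
    rw [Finsupp.tsub_apply, Finsupp.filter_apply_neg _ _ (fun hO => hO a b rfl), tsub_zero]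
  have hsupp : (v - u.filter fun e => ∀ a b, e ≠ (er a, ec b)).support ⊆
      Finset.univ.image (fun p : Fin m × Fin m => (er p.1, ec p.2)) := by
    intro e he
    rw [Finsupp.mem_support_iff, Finsupp.tsub_apply, Finsupp.filter_apply] at he
    by_cases hoe : ∀ a b, e ≠ (er a, ec b)
    · rw [if_pos hoe, hoff e hoe, tsub_self] at he
      exact absurd rfl he
    · simp only [not_forall, ne_eq, not_not] at hoe
      obtain ⟨a, b, rfl⟩ := hoe
      exact Finset.mem_image.2 ⟨(a, b), Finset.mem_univ _, rfl⟩
  rw [aeval_monomial, algebraMap_eq, monomial_eq,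
    Finsupp.prod_of_support_subset _ hsupp (fun i k => φ i ^ k) fun e _ => pow_zero _,
    Finset.prod_image fun p _ q _ hpq =>
      Prod.ext (her (Prod.mk.inj hpq).1) (hec (Prod.mk.inj hpq).2),
    Finsupp.prod_fintype _ (fun i k => X i ^ k) fun p => pow_zero _]
  congr 1
  refine Finset.prod_congr rfl fun p _ => ?_
  obtain ⟨a, b⟩ := p
  dsimp only
  rw [hφX, hblk, Finsupp.coe_equivFunOnFinite_symm]

/-- Over `ℝ≥0` there is no cancellation: a monomial occurs in a sum of monomials with nonzero
coefficients iff it is one of the exponents. [folklore] -/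
theorem mem_support_sum_monomial_iff {ι : Type*} (s : Finset ι) (f : ι → (Fin m × Fin m) →₀ ℕ)
    (c : ι → ℝ≥0) (w : (Fin m × Fin m) →₀ ℕ) (hc : ∀ i ∈ s, c i ≠ 0) :
    w ∈ (∑ i ∈ s, monomial (f i) (c i)).support ↔ ∃ i ∈ s, f i = w := by
  rw [mem_support_iff, coeff_sum]
  constructor
  · intro hne
    by_contra hex
    refine hne (Finset.sum_eq_zero fun i hi => ?_)
    rw [coeff_monomial, if_neg fun hfi => hex ⟨i, hi, hfi⟩]
  · rintro ⟨i, hi, rfl⟩ hzero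
    have h0 := Finset.sum_eq_zero_iff.1 hzero i hi
    rw [coeff_monomial, if_pos rfl] at h0
    exact hc i hi h0

/-! ### The chain: block projection and member descent -/

/-- **The intermediate polynomial of the rung.**  With `G = supp u ∪ Vr ×ˢ Vc`, `u_off` the
off-block part of `u`, `hV = Σ_{v ∈ Fib} h_v x^{v - u_off}` the shifted fibre polynomial and `h'`
the fibre polynomial transported to the block, `g = per_G · hV` satisfies: `per_m · h'` is a
projection of `g` (the block substitution `BlockProjection.exists_subst` is free,
`complexity_le_of_isProjection`, sends `per_G` to `per_m`, `BlockProjection.aeval_facePer_eq_perPoly`,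
and `hV` to `h'`, `aeval_monomial_fibre`), and `x^{u_off} · g = per_G · h|_G` is bounded by
member descent (`MemberDescent.stub_memberDescent`, `filter_host_eq_fibre`,
`monomial_fibre_eq_mul`). [folklore] -/
theorem exists_intermediate (h : MvPolynomial (Fin n × Fin n) ℝ≥0) (u : (Fin n × Fin n) →₀ ℕ)
    (er ec : Fin m → Fin n) (M₀ : Fin n → Fin n) (hu : u ∈ h.support)
    (hτ : ∃ τ : (Fin n →₀ ℕ) × (Fin n →₀ ℕ),
      ∀ v ∈ h.support, (Finsupp.mapDomain Prod.fst v, Finsupp.mapDomain Prod.snd v) = τ)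
    (hdom : ∀ v ∈ h.support, ∀ e ∈ u.support, v e ≤ u e)
    (her : Function.Injective er) (hec : Function.Injective ec)
    (hM₀ : ∀ j, (∀ b, ec b ≠ j) → (M₀ j, j) ∈ u.support ∧ ∀ a, er a ≠ M₀ j)
    (hMinj : ∀ j j', (∀ b, ec b ≠ j) → (∀ b, ec b ≠ j') → M₀ j = M₀ j' → j = j') :
    ∃ g : MvPolynomial (Fin n × Fin n) ℝ≥0,
      complexity (perPoly (Fin m) ℝ≥0 *
          ∑ v ∈ h.support.filter
              (fun v => ∀ e : Fin n × Fin n, (∀ a b, e ≠ (er a, ec b)) → v e = u e),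
            monomial (Finsupp.equivFunOnFinite.symm fun p : Fin m × Fin m => v (er p.1, ec p.2))
              (coeff v h)) ≤ complexity g ∧
      complexity (monomial (u.filter fun e => ∀ a b, e ≠ (er a, ec b)) (1 : ℝ≥0) * g) ≤
        complexity (perPoly (Fin n) ℝ≥0 * h) := by
  obtain ⟨φ, hproj, hφX, hφ1, hφ0⟩ := BlockProjection.exists_subst (M₀ := M₀) her hec
  -- the host contains the block and the matching cells
  have hA : ∀ a b, (er a, ec b) ∈ u.support ∪ (Finset.univ.image er) ×ˢ (Finset.univ.image ec) :=
    fun a b => Finset.mem_union_right _ (Finset.mem_product.2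
      ⟨Finset.mem_image_of_mem _ (Finset.mem_univ a), Finset.mem_image_of_mem _ (Finset.mem_univ b)⟩)
  have hM : ∀ j, (∀ b, ec b ≠ j) →
      (M₀ j, j) ∈ u.support ∪ (Finset.univ.image er) ×ˢ (Finset.univ.image ec) ∧
        ∀ a, er a ≠ M₀ j :=
    fun j hj => ⟨Finset.mem_union_left _ (hM₀ j hj).1, (hM₀ j hj).2⟩
  refine ⟨facePer (u.support ∪ (Finset.univ.image er) ×ˢ (Finset.univ.image ec)) *
      ∑ v ∈ h.support.filter
          (fun v => ∀ e : Fin n × Fin n, (∀ a b, e ≠ (er a, ec b)) → v e = u e),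
        monomial (v - u.filter fun e => ∀ a b, e ≠ (er a, ec b)) (coeff v h), ?_, ?_⟩
  · -- the block projection is free and sends `per_G · hV` to `per_m · h'`
    refine complexity_le_of_isProjection ⟨φ, hproj, ?_⟩
    rw [map_mul, BlockProjection.aeval_facePer_eq_perPoly her hec hA hM hMinj hφX hφ1 hφ0, map_sum]
    congr 1
    exact Finset.sum_congr rfl fun v hv =>
      (aeval_monomial_fibre her hec hφX u (Finset.mem_filter.1 hv).2 _).symm
  · -- `x^{u_off} · (per_G · hV) = per_G · h|_G`, bounded by member descent
    have hmd := MemberDescent.stub_memberDescent n h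
      (u.support ∪ (Finset.univ.image er) ×ˢ (Finset.univ.image ec))
    rw [filter_host_eq_fibre h u er ec hu hτ hdom] at hmd
    rw [mul_left_comm, Finset.mul_sum]
    refine le_of_eq_of_le (congr_arg complexity (congr_arg _ ?_)) hmd
    exact Finset.sum_congr rfl fun v hv =>
      (monomial_fibre_eq_mul u er ec (Finset.mem_filter.1 hv).2 (coeff v h)).symm

/-! ### The stub -/

/-- **Block fibre rung (stub `stub_blockFibreRung`, W, of line `Sketch_ideator4`).**  For a
torus-homogeneous multiplier `h` over `ℝ≥0` with a dominant monomial `u`, a block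
`er(Fin m) × ec(Fin m)` and an injective matching `j ↦ (M₀ j, j) ∈ supp u` of the columns off `ec`
into rows off `er`, the fibre polynomial `h'` on the block — whose monomials are the block
restrictions of the monomials of `h` equal to `u` off the block — satisfies
`L(per_m · h') ≤ ((n+2)(L(per_n · h)+3))^k`: the host `supp u ∪ Vr ×ˢ Vc` carries exactly the
block fibre (`filter_host_eq_fibre`), member descent bounds `per_G · h|_G = x^{u_off} · (per_G · hV)`
(`exists_intermediate`), the Jukna–Seiwert–Sergeev contraction (`stub_jssContraction`) strips
`x^{u_off}`, and the block projection sends `per_G · hV` to `per_m · h'` for free. [folklore] -/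
theorem stub_blockFibreRung :
    ∃ k : ℕ, ∀ (n m : ℕ) (h : MvPolynomial (Fin n × Fin n) ℝ≥0) (u : (Fin n × Fin n) →₀ ℕ)
      (er ec : Fin m → Fin n) (M₀ : Fin n → Fin n),
      u ∈ h.support →
      (∃ τ : (Fin n →₀ ℕ) × (Fin n →₀ ℕ),
        ∀ v ∈ h.support, (Finsupp.mapDomain Prod.fst v, Finsupp.mapDomain Prod.snd v) = τ) →
      (∀ v ∈ h.support, ∀ e ∈ u.support, v e ≤ u e) →
      Function.Injective er → Function.Injective ec →
      (∀ j, (∀ b, ec b ≠ j) → (M₀ j, j) ∈ u.support ∧ ∀ a, er a ≠ M₀ j) →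
      (∀ j j', (∀ b, ec b ≠ j) → (∀ b, ec b ≠ j') → M₀ j = M₀ j' → j = j') →
      ∃ h' : MvPolynomial (Fin m × Fin m) ℝ≥0,
        (∀ w : (Fin m × Fin m) →₀ ℕ, w ∈ h'.support ↔
          ∃ v ∈ h.support, (∀ e : Fin n × Fin n, (∀ a b, e ≠ (er a, ec b)) → v e = u e) ∧
            ∀ a b, w (a, b) = v (er a, ec b)) ∧
        complexity (perPoly (Fin m) ℝ≥0 * h') ≤
          ((n + 2) * (complexity (perPoly (Fin n) ℝ≥0 * h) + 3)) ^ k := by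
  obtain ⟨κ, hκ⟩ := DivisionGapPerDivisionHard.stub_jssContraction
  refine ⟨κ, ?_⟩
  intro n m h u er ec M₀ hu hτ hdom her hec hM₀ hMinj
  obtain ⟨g, hg, hmd⟩ := exists_intermediate h u er ec M₀ hu hτ hdom her hec hM₀ hMinj
  refine ⟨∑ v ∈ h.support.filter
        (fun v => ∀ e : Fin n × Fin n, (∀ a b, e ≠ (er a, ec b)) → v e = u e),
      monomial (Finsupp.equivFunOnFinite.symm fun p : Fin m × Fin m => v (er p.1, ec p.2))
        (coeff v h), fun w => ?_, ?_⟩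
  · -- the monomials of `h'` are the block restrictions of the fibre
    refine (mem_support_sum_monomial_iff _ _ _ w fun v hv =>
      mem_support_iff.1 (Finset.mem_filter.1 hv).1).trans ⟨?_, ?_⟩
    · rintro ⟨v, hv, rfl⟩
      obtain ⟨hv, hoff⟩ := Finset.mem_filter.1 hv
      exact ⟨v, hv, hoff, fun a b => rfl⟩
    · rintro ⟨v, hv, hoff, hw⟩
      exact ⟨v, Finset.mem_filter.2 ⟨hv, hoff⟩, Finsupp.ext fun ⟨a, b⟩ => (hw a b).symm⟩
  · -- block projection ≤ JSS contraction ≤ member descent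
    calc complexity (perPoly (Fin m) ℝ≥0 * _)
        ≤ complexity g := hg
      _ ≤ ((n + 2) * (complexity
            (monomial (u.filter fun e => ∀ a b, e ≠ (er a, ec b)) (1 : ℝ≥0) * g) + 2)) ^ κ :=
          hκ n g _
      _ ≤ ((n + 2) * (complexity (perPoly (Fin n) ℝ≥0 * h) + 3)) ^ κ :=
          Nat.pow_le_pow_left (Nat.mul_le_mul_left _ (by omega)) κ

end Summit.ValiantsHypothesis.ValiantsHypothesis.Theorems.DivisionGap.PerCofactorDegreeReduction.BlockFibre

end
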